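import Mathlib

/-!
# Crux `EnsembleRealization` (stmt-AnomalousDissipation-0215) — line `augmented-lift`,
# sub-stub M1 `stub_augCurrent`, piece (M1a)/L2: the one-sided mollifier and the CEI profiles

Supports stmt-AnomalousDissipation-0215 (stub `stub_augCurrent` of line `augmented-lift`, piece
M1a `stub_augCurrentLevelPairs`, step (A2) of `augCurrent-notes.md` §3). Nothing here closes an
item. Theorems only.

The product mollifier `ρ = ρ₁ ⊗ ρ₂` of the augmented current: `ρ₁` a normalized smooth bump of
radius `δ` on `ℝ^D`, `ρ₂` a normalized smooth bump on `ℝ` supported in `(0, δ)` (ONE-SIDED in the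
energy variable), its primitive `P₂ = ∫₀^· ρ₂` (smooth, values in `[0, 1]`, `0` below `0`, `1`
above `δ`, monotone), and the CEI PROFILE `ψ_z(ζ) = −ρ₁(w − ξ) P₂(e − e')` (`z = (w, e)`,
`ζ = (ξ, e')`): `C¹`, bounded with bounded derivative, nondecreasing in `e'`, with
`∂_{e'} ψ_z(ζ) = ρ(z − ζ) ≥ 0` and `∂_ξ ψ_z(ζ)[v] = Dρ₁(w − ξ)[v] P₂(e − e')` — exactly the
hypotheses and the two directional derivatives consumed by the cylindrical energy inequalities
`CEI(ν, f, μ)`. Packaged as `stub_augCurrentProfileTools`.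
-/

noncomputable section

set_option linter.dupNamespace false

open MeasureTheory Set Filter Topology Function Metric
open scoped BigOperators ContDiff

namespace Summit.AnomalousDissipation.AnomalousDissipation.Theorems.EnsembleRealization

/-! ### The one-sided mollifier on `ℝ` and its primitive -/

/-- **One-sided mollifier.** For `δ > 0` there are smooth `ρ₂, P₂ : ℝ → ℝ` with `ρ₂ ≥ 0`
supported in `(0, δ)`, `∫ ρ₂ = 1`, `ρ₂` bounded, `P₂' = ρ₂`, `P₂ = 0` on `(-∞, 0]`, `P₂ = 1` on
`[δ, ∞)`, `0 ≤ P₂ ≤ 1`, `P₂` monotone. -/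
theorem exists_oneSided_mollifier {δ : ℝ} (hδ : 0 < δ) :
    ∃ ρ₂ P₂ : ℝ → ℝ, ContDiff ℝ ∞ ρ₂ ∧ ContDiff ℝ ∞ P₂ ∧ (∀ s, 0 ≤ ρ₂ s) ∧
      (∀ s, s ∉ Ioo 0 δ → ρ₂ s = 0) ∧ (∫ s, ρ₂ s = 1) ∧ (∃ M : ℝ, ∀ s, ρ₂ s ≤ M) ∧
      (∀ s, HasDerivAt P₂ (ρ₂ s) s) ∧ (∀ s, s ≤ 0 → P₂ s = 0) ∧ (∀ s, δ ≤ s → P₂ s = 1) ∧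
      (∀ s, 0 ≤ P₂ s ∧ P₂ s ≤ 1) ∧ Monotone P₂ := by
  let β : ContDiffBump (δ / 2 : ℝ) := ⟨δ / 4, δ / 2, by positivity, by linarith⟩
  set ρ₂ : ℝ → ℝ := β.normed volume with hρ₂
  set P₂ : ℝ → ℝ := fun s => ∫ t in (0 : ℝ)..s, ρ₂ t with hP₂
  have hρc : ContDiff ℝ ∞ ρ₂ := β.contDiff_normed
  have hρnn : ∀ s, 0 ≤ ρ₂ s := fun s => β.nonneg_normed s
  have hsupp : ∀ s, s ∉ Ioo 0 δ → ρ₂ s = 0 := fun s hs => by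
    have h : s ∉ Function.support ρ₂ := by
      rw [hρ₂, β.support_normed_eq, Real.ball_eq_Ioo]
      have h1 : δ / 2 - β.rOut = 0 := by show δ / 2 - δ / 2 = 0; ring
      have h2 : δ / 2 + β.rOut = δ := by show δ / 2 + δ / 2 = δ; ring
      rwa [h1, h2]
    simpa [Function.mem_support] using h
  have hint : ∫ s, ρ₂ s = 1 := β.integral_normed
  have hbd : ∃ M : ℝ, ∀ s, ρ₂ s ≤ M := ⟨(∫ x, β x)⁻¹, fun s => by
    rw [hρ₂, β.normed_def, div_eq_mul_inv]
    exact mul_le_of_le_one_left (inv_nonneg.2 (integral_nonneg fun _ => β.nonneg)) β.le_one⟩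
  have hcont : Continuous ρ₂ := β.continuous_normed
  have hder : ∀ s, HasDerivAt P₂ (ρ₂ s) s := fun s =>
    intervalIntegral.integral_hasDerivAt_right (hcont.intervalIntegrable _ _)
      (hcont.stronglyMeasurableAtFilter _ _) hcont.continuousAt
  have hdiff : Differentiable ℝ P₂ := fun s => (hder s).differentiableAt
  have hderiv : deriv P₂ = ρ₂ := funext fun s => (hder s).deriv
  have hPc : ContDiff ℝ ∞ P₂ := contDiff_infty_iff_deriv.2 ⟨hdiff, by rw [hderiv]; exact hρc⟩
  have hmono : Monotone P₂ := monotone_of_deriv_nonneg hdiff fun s => by rw [hderiv]; exact hρnn s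
  have hzero : ∀ s, s ≤ 0 → P₂ s = 0 := fun s hs => by
    show ∫ t in (0 : ℝ)..s, ρ₂ t = 0
    rw [intervalIntegral.integral_congr (g := fun _ => (0 : ℝ)) fun t ht => ?_]
    · simp
    · rw [uIcc_of_ge hs] at ht
      exact hsupp t fun h => by linarith [h.1, ht.2]
  have hone : ∀ s, δ ≤ s → P₂ s = 1 := fun s hs => by
    show ∫ t in (0 : ℝ)..s, ρ₂ t = 1
    rw [intervalIntegral.integral_eq_integral_of_support_subset, hint]
    intro t ht
    by_contra h
    exact ht (hsupp t fun h' => h ⟨h'.1, h'.2.le.trans hs⟩)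
  have h01 : ∀ s, 0 ≤ P₂ s ∧ P₂ s ≤ 1 := fun s =>
    ⟨by rw [← hzero (min s 0) (min_le_right _ _)]; exact hmono (min_le_left _ _),
      by rw [← hone (max s δ) (le_max_right _ _)]; exact hmono (le_max_left _ _)⟩
  exact ⟨ρ₂, P₂, hρc, hPc, hρnn, hsupp, hint, hbd, hder, hzero, hone, h01, hmono⟩

/-! ### The packaged profile tools -/

/-- **Profile tools for (M1a).** For `D : ℕ` and `δ > 0`: a normalized smooth bump `ρ₁ ≥ 0` on
`ℝ^D` vanishing off `ball 0 δ` with `∫ ρ₁ = 1` and bounded `ρ₁`, `‖Dρ₁‖`; the one-sided mollifier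
`ρ₂` and its primitive `P₂` of `exists_oneSided_mollifier`; and, for every `z = (w, e)`, the CEI
profile `ζ ↦ −ρ₁(w − ζ.1) P₂(e − ζ.2)`: `C¹`, `|ψ| ≤ C` and `‖Dψ‖ ≤ C`, nondecreasing in the energy
variable, `Dψ(ζ)(0, 1) = ρ₁(w − ζ.1) ρ₂(e − ζ.2)` and `Dψ(ζ)(v, 0) = Dρ₁(w − ζ.1)[v] P₂(e − ζ.2)`. -/
theorem stub_augCurrentProfileTools (D : ℕ) {δ : ℝ} (hδ : 0 < δ) :
    ∃ (ρ₁ : EuclideanSpace ℝ (Fin D) → ℝ) (ρ₂ P₂ : ℝ → ℝ),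
      ContDiff ℝ ∞ ρ₁ ∧ (∀ y, 0 ≤ ρ₁ y) ∧ (∀ y, δ ≤ ‖y‖ → ρ₁ y = 0) ∧ (∫ y, ρ₁ y = 1) ∧
      HasCompactSupport ρ₁ ∧ (∃ M : ℝ, ∀ y, ρ₁ y ≤ M ∧ ‖fderiv ℝ ρ₁ y‖ ≤ M) ∧
      ContDiff ℝ ∞ ρ₂ ∧ ContDiff ℝ ∞ P₂ ∧ (∀ s, 0 ≤ ρ₂ s) ∧
      (∀ s, s ∉ Ioo 0 δ → ρ₂ s = 0) ∧ (∫ s, ρ₂ s = 1) ∧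
      (∀ s, HasDerivAt P₂ (ρ₂ s) s) ∧ (∀ s, s ≤ 0 → P₂ s = 0) ∧ (∀ s, δ ≤ s → P₂ s = 1) ∧
      (∀ s, 0 ≤ P₂ s ∧ P₂ s ≤ 1) ∧ Monotone P₂ ∧
      (∀ z : EuclideanSpace ℝ (Fin D) × ℝ,
        ContDiff ℝ 1 (fun ζ : EuclideanSpace ℝ (Fin D) × ℝ => -(ρ₁ (z.1 - ζ.1) * P₂ (z.2 - ζ.2))) ∧
        (∃ C : ℝ, ∀ ζ : EuclideanSpace ℝ (Fin D) × ℝ, |-(ρ₁ (z.1 - ζ.1) * P₂ (z.2 - ζ.2))| ≤ C ∧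
          ‖fderiv ℝ (fun ζ : EuclideanSpace ℝ (Fin D) × ℝ => -(ρ₁ (z.1 - ζ.1) * P₂ (z.2 - ζ.2))) ζ‖ ≤ C) ∧
        (∀ ξ : EuclideanSpace ℝ (Fin D), Monotone fun e : ℝ => -(ρ₁ (z.1 - ξ) * P₂ (z.2 - e))) ∧
        (∀ ζ : EuclideanSpace ℝ (Fin D) × ℝ,
          fderiv ℝ (fun ζ : EuclideanSpace ℝ (Fin D) × ℝ => -(ρ₁ (z.1 - ζ.1) * P₂ (z.2 - ζ.2))) ζ (0, 1) =
            ρ₁ (z.1 - ζ.1) * ρ₂ (z.2 - ζ.2)) ∧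
        (∀ (ζ : EuclideanSpace ℝ (Fin D) × ℝ) (v : EuclideanSpace ℝ (Fin D)),
          fderiv ℝ (fun ζ : EuclideanSpace ℝ (Fin D) × ℝ => -(ρ₁ (z.1 - ζ.1) * P₂ (z.2 - ζ.2))) ζ (v, 0) =
            fderiv ℝ ρ₁ (z.1 - ζ.1) v * P₂ (z.2 - ζ.2))) := by
  obtain ⟨ρ₂, P₂, hρc, hPc, hρnn, hsupp, hint, ⟨M₂, hM₂⟩, hder, hzero, hone, h01, hmono⟩ :=
    exists_oneSided_mollifier hδ
  let β : ContDiffBump (0 : EuclideanSpace ℝ (Fin D)) := ⟨δ / 2, δ, by positivity, by linarith⟩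
  set ρ₁ : EuclideanSpace ℝ (Fin D) → ℝ := β.normed volume with hρ₁
  have h1c : ContDiff ℝ ∞ ρ₁ := β.contDiff_normed
  have h1nn : ∀ y, 0 ≤ ρ₁ y := fun y => β.nonneg_normed y
  have h1supp : ∀ y, δ ≤ ‖y‖ → ρ₁ y = 0 := fun y hy => by
    have h : y ∉ Function.support ρ₁ := by
      rw [hρ₁, β.support_normed_eq, mem_ball_zero_iff, not_lt]
      exact hy
    simpa [Function.mem_support] using h
  have h1int : ∫ y, ρ₁ y = 1 := β.integral_normed
  have h1cs : HasCompactSupport ρ₁ := β.hasCompactSupport_normed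
  -- bounds on `ρ₁` and `Dρ₁`
  have h1bd : ∀ y, ρ₁ y ≤ (∫ x, β x)⁻¹ := fun y => by
    rw [hρ₁, β.normed_def, div_eq_mul_inv]
    exact mul_le_of_le_one_left (inv_nonneg.2 (integral_nonneg fun _ => β.nonneg)) β.le_one
  have h1one : ContDiff ℝ 1 ρ₁ := h1c.of_le (by exact_mod_cast le_top)
  obtain ⟨K₁, hK₁⟩ := (h1cs.fderiv ℝ).exists_bound_of_continuous (h1one.continuous_fderiv one_ne_zero)
  set M₁ : ℝ := max ((∫ x, β x)⁻¹) (max K₁ 0) with hM₁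
  have hM₁ρ : ∀ y, ρ₁ y ≤ M₁ := fun y => (h1bd y).trans (le_max_left _ _)
  have hM₁D : ∀ y, ‖fderiv ℝ ρ₁ y‖ ≤ M₁ := fun y => (hK₁ y).trans ((le_max_left _ _).trans (le_max_right _ _))
  have hM₁0 : 0 ≤ M₁ := (le_max_right K₁ 0).trans (le_max_right _ _)
  have hM₂0 : 0 ≤ M₂ := (hρnn 0).trans (hM₂ 0)
  refine ⟨ρ₁, ρ₂, P₂, h1c, h1nn, h1supp, h1int, h1cs, ⟨M₁, fun y => ⟨hM₁ρ y, hM₁D y⟩⟩, hρc, hPc,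
    hρnn, hsupp, hint, hder, hzero, hone, h01, hmono, fun z => ?_⟩
  -- the profile at `z`
  have hd1 : Differentiable ℝ ρ₁ := h1one.differentiable one_ne_zero
  -- derivative of the profile
  have hA : ∀ ζ : EuclideanSpace ℝ (Fin D) × ℝ, HasFDerivAt (fun ζ : EuclideanSpace ℝ (Fin D) × ℝ => ρ₁ (z.1 - ζ.1))
      ((fderiv ℝ ρ₁ (z.1 - ζ.1)).comp (0 - ContinuousLinearMap.fst ℝ (EuclideanSpace ℝ (Fin D)) ℝ)) ζ :=
    fun ζ => (hd1 _).hasFDerivAt.comp ζ ((hasFDerivAt_const z.1 ζ).sub hasFDerivAt_fst)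
  have hB : ∀ ζ : EuclideanSpace ℝ (Fin D) × ℝ, HasFDerivAt (fun ζ : EuclideanSpace ℝ (Fin D) × ℝ => P₂ (z.2 - ζ.2))
      (ρ₂ (z.2 - ζ.2) • (0 - ContinuousLinearMap.snd ℝ (EuclideanSpace ℝ (Fin D)) ℝ)) ζ :=
    fun ζ => (hder _).comp_hasFDerivAt ζ ((hasFDerivAt_const z.2 ζ).sub hasFDerivAt_snd)
  have hψ : ∀ ζ : EuclideanSpace ℝ (Fin D) × ℝ,
      HasFDerivAt (fun ζ : EuclideanSpace ℝ (Fin D) × ℝ => -(ρ₁ (z.1 - ζ.1) * P₂ (z.2 - ζ.2)))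
        (-(ρ₁ (z.1 - ζ.1) • (ρ₂ (z.2 - ζ.2) • (0 - ContinuousLinearMap.snd ℝ (EuclideanSpace ℝ (Fin D)) ℝ)) +
          P₂ (z.2 - ζ.2) • ((fderiv ℝ ρ₁ (z.1 - ζ.1)).comp
            (0 - ContinuousLinearMap.fst ℝ (EuclideanSpace ℝ (Fin D)) ℝ)))) ζ :=
    fun ζ => ((hA ζ).mul (hB ζ)).neg
  have hsm : ContDiff ℝ 1 (fun ζ : EuclideanSpace ℝ (Fin D) × ℝ => -(ρ₁ (z.1 - ζ.1) * P₂ (z.2 - ζ.2))) := by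
    have h2 : ContDiff ℝ 1 P₂ := hPc.of_le (by exact_mod_cast le_top)
    exact ((h1one.comp (contDiff_const.sub contDiff_fst)).mul (h2.comp (contDiff_const.sub contDiff_snd))).neg
  refine ⟨hsm, ⟨M₁ + (M₁ * M₂ + M₁), fun ζ => ⟨?_, ?_⟩⟩, fun ξ e₁ e₂ he => ?_, fun ζ => ?_, fun ζ v => ?_⟩
  · -- `|ψ| ≤ C`
    rw [abs_neg, abs_mul, abs_of_nonneg (h1nn _), abs_of_nonneg (h01 _).1]
    have := mul_le_mul (hM₁ρ (z.1 - ζ.1)) (h01 (z.2 - ζ.2)).2 (h01 _).1 hM₁0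
    nlinarith [mul_nonneg hM₁0 hM₂0]
  · -- `‖Dψ‖ ≤ C`
    rw [(hψ ζ).fderiv, norm_neg]
    have hfst : ‖(0 : EuclideanSpace ℝ (Fin D) × ℝ →L[ℝ] EuclideanSpace ℝ (Fin D)) -
        ContinuousLinearMap.fst ℝ (EuclideanSpace ℝ (Fin D)) ℝ‖ ≤ 1 := by
      rw [zero_sub, norm_neg]; exact ContinuousLinearMap.norm_fst_le _ _ _
    have hsnd : ‖(0 : EuclideanSpace ℝ (Fin D) × ℝ →L[ℝ] ℝ) - ContinuousLinearMap.snd ℝ (EuclideanSpace ℝ (Fin D)) ℝ‖ ≤ 1 := by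
      rw [zero_sub, norm_neg]; exact ContinuousLinearMap.norm_snd_le _ _ _
    calc _ ≤ ‖ρ₁ (z.1 - ζ.1) • (ρ₂ (z.2 - ζ.2) • (0 - ContinuousLinearMap.snd ℝ (EuclideanSpace ℝ (Fin D)) ℝ))‖ +
          ‖P₂ (z.2 - ζ.2) • ((fderiv ℝ ρ₁ (z.1 - ζ.1)).comp
            (0 - ContinuousLinearMap.fst ℝ (EuclideanSpace ℝ (Fin D)) ℝ))‖ := norm_add_le _ _
      _ ≤ M₁ * M₂ + M₁ := by
          gcongr
          · rw [norm_smul, norm_smul, Real.norm_of_nonneg (h1nn _), Real.norm_of_nonneg (hρnn _)]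
            calc ρ₁ (z.1 - ζ.1) * (ρ₂ (z.2 - ζ.2) * _) ≤ M₁ * (M₂ * 1) :=
                  mul_le_mul (hM₁ρ _) (mul_le_mul (hM₂ _) hsnd (norm_nonneg _) hM₂0)
                    (mul_nonneg (hρnn _) (norm_nonneg _)) hM₁0
              _ = M₁ * M₂ := by ring
          · rw [norm_smul, Real.norm_of_nonneg (h01 _).1]
            calc P₂ (z.2 - ζ.2) * _ ≤ 1 * (M₁ * 1) :=
                  mul_le_mul (h01 _).2 ((ContinuousLinearMap.opNorm_comp_le _ _).trans
                    (mul_le_mul (hM₁D _) hfst (norm_nonneg _) hM₁0)) (norm_nonneg _) zero_le_one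
              _ = M₁ := by ring
      _ ≤ M₁ + (M₁ * M₂ + M₁) := by linarith
  · -- monotone in the energy variable
    simp only [neg_le_neg_iff]
    exact mul_le_mul_of_nonneg_left (hmono (by linarith)) (h1nn _)
  · -- `Dψ(ζ)(0, 1) = ρ(z - ζ)`
    rw [(hψ ζ).fderiv]
    simp [smul_eq_mul]
  · -- `Dψ(ζ)(v, 0) = Dρ₁(w - ζ.1)[v] P₂(e - ζ.2)`
    rw [(hψ ζ).fderiv]
    simp [smul_eq_mul, mul_comm]

end Summit.AnomalousDissipation.AnomalousDissipation.Theorems.EnsembleRealization
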